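import Summits.ResolutionOfSingularities.ResolutionOfSingularities.Theorems.HilbertSamuelEliminationSigmaMaxModificationsCorridor3WLadderMovingPsi
import Summits.ResolutionOfSingularities.ResolutionOfSingularities.Theorems.HilbertSamuelEliminationSigmaMaxModificationsCorridor3NearStep
import Summits.ResolutionOfSingularities.ResolutionOfSingularities.Theorems.HilbertSamuelEliminationSigmaMaxModificationsCorridor3RegularValue
import Literature.AlgebraicGeometry.Resolution.PsiBlowup
import Literature.AlgebraicGeometry.Resolution.BlowupReducedDimension
import Literature.RingTheory.HilbertSamuel.PhiUpperBound
import HarnessLib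

/-!
# [OURS · L1 W4.2] `ψ`-STABILITY ALONG ONE CANONICAL NEAR STEP (pool object of RULINGS v3.10-2 (β);
# crux `SigmaMaxModifications` stmt-ResolutionOfSingularities-18506, conjunct `SigmaMaxModificationsCorridor3`
# stmt-…-19249; line `w_ladder` v6) — `theorem psiStableNearStepM : Moving.PsiStableNearStepM p N`

Pool prover res-type-071 (gen 17) on res-L1-w42-plan-1's RULINGS v3.10-2 (β) (first free reserve; booked by res-plan-2
MAP v1.19). Helper file `--supports stmt-ResolutionOfSingularities-19249`; kernel only (no named facts, no `sorry`).

WHAT IS PROVED. `Moving.PsiStableNearStepM p N` (typed by res-type-053, `…Corridor3WLadderMovingPsi`): for every functional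
admissible oracle `R`, level `N`, value `ν`, maximal origin `(X, x)` of characteristic `p`, and every canonical near step
`s → s'` from a stage `s` REACHED from `(X, x)`, the invariant `ψ` of CJS Def. 2.28 (2)
(`ψ_X(x) = min{codim_Z(x) | Z ∋ x an irreducible component}`, tree `Scheme.hsPsi`) does not change:
`ψ_{X_{n+1}}(x_{n+1}) = ψ_{X_n}(x_n)`. Consumers (053): `psiStableAlongReachesM_of_nearStep`,
`edimStableAlongReachesM_of_psiStable` — along canonical near chains from a maximal origin the embedding dimension is constant
(the `QEdim4` / E5 cells of `…Corridor3WLadderMovingCells`).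

PROOF (route of res-L1-w42-stub-1 06:50:00Z (a)–(d) + res-type-053 WHY-TRUE 06:46:45Z, all pieces in the tree).
* WAITING step (the marked point is not blown up): the blow-down map is an isomorphism of local rings at the new marked point
  (`CanonicalNearStep.exists_isIso_stalkMap_of_not_isBlownUp`), and `ψ` depends only on the local ring
  (`Scheme.hsPsi_eq_of_isIso_stalkMap`). This covers the regular value `ν = Φ^{(N)}` entirely: there no genuine step has a
  successor (`IsMaximalOrigin.not_isBlownUp_of_eq_iterPSum`).
* GENUINE step, `ν ≠ Φ^{(N)}` (`CanonicalNearStep.exists_genuine`: `π : X_{n+1} → X_n` is the blow-up of a permissible centre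
  of an excellent stage of dimension `≤ N`, `x_{n+1}` closed over the closed point `x_n`, `H^N(x_{n+1}) = H^N(x_n) = ν`):
  (a) `ψ(x_n) ≤ ψ(x_{n+1})` — CJS (3.7) with `δ = 0`, tree `IsBlowup.hsPsi_le_of_residuallyIntegral` (universal catenarity of
  `𝒪_{X_n,x_n}` from excellence, residual integrality from the finiteness of `κ(x_{n+1})/κ(x_n)` at a closed point,
  `finite_residueFieldMap_of_isClosed`); (b) `dim 𝒪_{x_{n+1}} ≤ dim 𝒪_{x_n}` — tree
  `IsBlowup.ringKrullDim_stalk_le_of_isLocallyNoetherian` (dimension inequality); (c) `H^{(N-ψ')}(𝒪') = H^{(N-ψ)}(𝒪)` forces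
  `dim 𝒪' + (N - ψ') = dim 𝒪 + (N - ψ)` (CJS Lemma 2.25 (b) both ways, tree `dim_add_le_of_hilbertSamuelFun_le`);
  (d) arithmetic with `ψ ≤ ψ' ≤ dim 𝒪' ≤ dim 𝒪 ≤ N`: `ψ' = ψ` (and `dim 𝒪' = dim 𝒪`, exported as
  `ringKrullDim_stalk_eq_of_canonicalNearStep`).

CHAIN FORMS BY NAME (§4, now unconditional, via 053's reductions of `…Corridor3WLadderMovingPsi`): `psiStableAlongReachesM p N :
PsiStableAlongReachesM p N`, `edimStableAlongReachesM p N : EdimStableAlongReachesM p N` (the embedding dimension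
`dim_{κ(x_n)} 𝔪_{x_n}/𝔪_{x_n}²` is constant along canonical near chains from a maximal origin), `hsPhi_eq_of_reaches` (`φ^N` constant),
`ringKrullDim_stalk_eq_of_reaches` (`dim 𝒪_{X_n,x_n}` constant), `edim_le_four_iff_qEdim4_of_reaches` (the origin door `QEdim4` of
the E5 / `QEdim4` cells is read at ANY reached stage).

OURS bookkeeping over the tree's rendering of CJS Rem. 6.29 (1); NOT a statement of the manuscript [Hironaka2017] nor of
[CossartJannsenSaito2020]. AI-written; AI review is weaker than expert review.

## References
* V. Cossart, U. Jannsen, S. Saito, *Desingularization: Invariants and Strategy*, LNM 2270 (2020): Def. 2.28 (2), Lemma 2.25 (b),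
  Thm. 3.10 (1) with (3.7)–(3.8), Rem. 6.29 (1). [CossartJannsenSaito2020]
* H. Matsumura, *Commutative Ring Theory* (1986), Thm. 15.5 (dimension inequality). [Matsumura1987]
-/

noncomputable section

set_option linter.dupNamespace false

open CategoryTheory AlgebraicGeometry TopologicalSpace IsLocalRing
open Summit.ResolutionOfSingularities.ResolutionOfSingularities.Theorems.CampaignW42
open Literature.AlgebraicGeometry.Resolution Literature.RingTheory.HilbertSamuel

namespace Summit.ResolutionOfSingularities.ResolutionOfSingularities.Theorems.SigmaMaxModificationsCorridor3.Moving

universe u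

/-! ## §1. The ring-level arithmetic (CJS Lemma 2.25 (b) both ways) -/

/-- **Arithmetic core.** For noetherian local rings `𝒪`, `𝒪'` with `H^{(N-ψ(𝒪'))}_{𝒪'} = H^{(N-ψ(𝒪))}_{𝒪}`,
`ψ(𝒪) ≤ ψ(𝒪')`, `dim 𝒪' ≤ dim 𝒪 ≤ N`: `ψ(𝒪') = ψ(𝒪)` and `dim 𝒪' = dim 𝒪` (`ψ = minimalPrimesCodim`; CJS Lemma 2.25 (b):
`H^{(b)}_{A'} ≤ H^{(a)}_A ⟹ dim A' + b ≤ dim A + a`, applied in both directions). [cite: CossartJannsenSaito2020, Lemma 2.25 (b)] -/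
theorem minimalPrimesCodim_eq_and_ringKrullDim_eq_of_hilbertSamuelFun_eq {O O' : Type u} [CommRing O] [CommRing O']
    [IsNoetherianRing O] [IsLocalRing O] [IsNoetherianRing O'] [IsLocalRing O'] {N : ℕ}
    (hH : hilbertSamuelFun O' (N - minimalPrimesCodim O') = hilbertSamuelFun O (N - minimalPrimesCodim O))
    (hψ : minimalPrimesCodim O ≤ minimalPrimesCodim O') (hdim : ringKrullDim O' ≤ ringKrullDim O)
    (hN : ringKrullDim O ≤ (N : WithBot ℕ∞)) :
    minimalPrimesCodim O' = minimalPrimesCodim O ∧ ringKrullDim O' = ringKrullDim O := by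
  obtain ⟨d, hd⟩ : ∃ d : ℕ, ringKrullDim O = d :=
    exists_nat_eq_of_ne_bot_of_ne_top ringKrullDim_ne_bot ringKrullDim_ne_top
  obtain ⟨d', hd'⟩ : ∃ d' : ℕ, ringKrullDim O' = d' :=
    exists_nat_eq_of_ne_bot_of_ne_top ringKrullDim_ne_bot ringKrullDim_ne_top
  have h1 : d' + (N - minimalPrimesCodim O') ≤ d + (N - minimalPrimesCodim O) :=
    dim_add_le_of_hilbertSamuelFun_le O hd hd' hH.le
  have h2 : d + (N - minimalPrimesCodim O) ≤ d' + (N - minimalPrimesCodim O') :=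
    dim_add_le_of_hilbertSamuelFun_le O' hd' hd hH.ge
  have hψ'd' : (minimalPrimesCodim O' : WithBot ℕ∞) ≤ d' := hd' ▸ minimalPrimesCodim_le_ringKrullDim O'
  have hd'd : (d' : WithBot ℕ∞) ≤ d := by rw [← hd, ← hd']; exact hdim
  have hdN : (d : WithBot ℕ∞) ≤ N := hd ▸ hN
  have e1 : minimalPrimesCodim O' ≤ d' := by exact_mod_cast hψ'd'
  have e2 : d' ≤ d := by exact_mod_cast hd'd
  have e3 : d ≤ N := by exact_mod_cast hdN
  refine ⟨by omega, ?_⟩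
  rw [hd, hd']
  exact_mod_cast (show d' = d by omega)

/-! ## §2. One GENUINE canonical near step: `ψ` and `dim 𝒪` are unchanged -/

/-- **`ψ` and `dim 𝒪_{x_n}` are unchanged along a GENUINE canonical near step** from a stage reached from a maximal origin
(functional admissible oracle). [cite: CossartJannsenSaito2020, Thm. 3.10 (1) (proof, (3.7)–(3.8)), Lemma 2.25 (b)] -/
theorem hsPsi_eq_and_ringKrullDim_stalk_eq_of_canonicalNearStep_of_isBlownUp {p : ℕ}
    {R : ∀ S : Scheme.{u}, CentreSeq S → Prop} (hRf : OracleFunctional R) (hRa : OracleAdmissible R) {N : ℕ} {ν : ℕ → ℕ}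
    {X : Scheme.{u}} [IsLocallyNoetherian X] {x : X} (hX : IsMaximalOrigin p N ν X x) {s s' : MarkedStage.{u}}
    (hs : Reaches R N ν (MarkedStage.init X x) s) (h : CanonicalNearStep R N ν s s') (hb : s.IsBlownUp R N ν) :
    Scheme.hsPsi s'.W s'.pt = Scheme.hsPsi s.W s.pt ∧
      ringKrullDim (s'.W.presheaf.stalk s'.pt) = ringKrullDim (s.W.presheaf.stalk s.pt) := by
  -- at the regular value no genuine step has a successor
  have hν : ν ≠ iterPSum N Phi := fun hν => hX.not_isBlownUp_of_eq_iterPSum hRf hRa hν hs h hb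
  obtain ⟨C, π, hπ, -, -, -, -, hbase, hcl', -, hH, -, -, hexc, hdim⟩ := h.exists_genuine hRf hRa hν hX hs hb
  letI := s.ln
  letI := s'.ln
  haveI : IsProper π := hπ.isProper
  -- (a) ψ(x_n) ≤ ψ(x_{n+1}): universal catenarity from excellence, residual integrality at a closed point
  have hUC : IsUniversallyCatenaryRing (s.W.presheaf.stalk (π.base s'.pt)) := hexc.isUniversallyCatenaryRing_stalk _
  have hfin := finite_residueFieldMap_of_isClosed π hcl'
  obtain ⟨T, hTgen, hTint⟩ := exists_residuallyFinite_of_finite_residueField (π.stalkMap s'.pt).hom hfin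
  have hint := exists_monic_map_eval_mem_of_residuallyFinite (π.stalkMap s'.pt).hom T hTgen hTint
  have hψle : Scheme.hsPsi s.W (π.base s'.pt) ≤ Scheme.hsPsi s'.W s'.pt :=
    hπ.hsPsi_le_of_residuallyIntegral s'.pt hUC hint
  -- (b) dim 𝒪_{x_{n+1}} ≤ dim 𝒪_{x_n}
  have hdimle : ringKrullDim (s'.W.presheaf.stalk s'.pt) ≤ ringKrullDim (s.W.presheaf.stalk (π.base s'.pt)) :=
    hπ.ringKrullDim_stalk_le_of_isLocallyNoetherian s'.pt
  rw [hbase] at hψle hdimle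
  -- dim 𝒪_{x_n} ≤ dim X_n ≤ N
  have hN : ringKrullDim (s.W.presheaf.stalk s.pt) ≤ (N : WithBot ℕ∞) := by
    refine le_trans ?_ hdim
    rw [AlgebraicGeometry.ringKrullDim_stalk_eq_coheight, topologicalKrullDim,
      Order.krullDim_eq_of_orderIso (irreducibleSetEquivPoints (α := s.W))]
    exact Order.coheight_le_krullDim s.pt
  -- (c)+(d)
  have hH' : hilbertSamuelFun (s'.W.presheaf.stalk s'.pt) (N - minimalPrimesCodim (s'.W.presheaf.stalk s'.pt)) =
      hilbertSamuelFun (s.W.presheaf.stalk s.pt) (N - minimalPrimesCodim (s.W.presheaf.stalk s.pt)) := hH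
  exact minimalPrimesCodim_eq_and_ringKrullDim_eq_of_hilbertSamuelFun_eq hH' hψle hdimle hN

/-! ## §3. The pool object -/

/-- **`ψ`-STABILITY ALONG ONE CANONICAL NEAR STEP (the pool object `Moving.PsiStableNearStepM`, PROVED).** Along a canonical
near step `s → s'` from a stage reached from a maximal origin (functional admissible oracle), `ψ_{X_{n+1}}(x_{n+1}) = ψ_{X_n}(x_n)`:
waiting steps are local isomorphisms; genuine steps by §2. [cite: CossartJannsenSaito2020, Def. 2.28 (2), Thm. 3.10 (1)] -/
theorem psiStableNearStepM (p N : ℕ) : PsiStableNearStepM.{u} p N := by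
  intro R hRf hRa ν X _ x hX s s' hs h
  by_cases hb : s.IsBlownUp R N ν
  · exact (hsPsi_eq_and_ringKrullDim_stalk_eq_of_canonicalNearStep_of_isBlownUp hRf hRa hX hs h hb).1
  · obtain ⟨π, hπ, _⟩ := h.exists_isIso_stalkMap_of_not_isBlownUp hb
    rw [← hπ]
    exact Scheme.hsPsi_eq_of_isIso_stalkMap π s'.pt

/-- **`dim 𝒪_{x_n}` is constant along one canonical near step** from a stage reached from a maximal origin (exported
by-product; waiting steps: isomorphic local rings). [cite: CossartJannsenSaito2020, Thm. 3.10 (1)] -/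
theorem ringKrullDim_stalk_eq_of_canonicalNearStep {p : ℕ} {R : ∀ S : Scheme.{u}, CentreSeq S → Prop}
    (hRf : OracleFunctional R) (hRa : OracleAdmissible R) {N : ℕ} {ν : ℕ → ℕ} {X : Scheme.{u}} [IsLocallyNoetherian X]
    {x : X} (hX : IsMaximalOrigin p N ν X x) {s s' : MarkedStage.{u}} (hs : Reaches R N ν (MarkedStage.init X x) s)
    (h : CanonicalNearStep R N ν s s') :
    ringKrullDim (s'.W.presheaf.stalk s'.pt) = ringKrullDim (s.W.presheaf.stalk s.pt) := by
  by_cases hb : s.IsBlownUp R N ν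
  · exact (hsPsi_eq_and_ringKrullDim_stalk_eq_of_canonicalNearStep_of_isBlownUp hRf hRa hX hs h hb).2
  · obtain ⟨e⟩ := h.nonempty_ringEquiv_stalk_of_not_isBlownUp hb
    exact (ringKrullDim_eq_of_ringEquiv e).symm


/-! ## §4. Chain forms BY NAME (053's reductions of `…Corridor3WLadderMovingPsi`, now unconditional) -/

/-- **`ψ` is constant along canonical near chains from a maximal origin** (`Moving.PsiStableAlongReachesM`, PROVED):
`ψ_{X_n}(x_n) = ψ_X(x)` at every stage reached from `(X, x)`. [cite: CossartJannsenSaito2020, Def. 2.28 (2)] -/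
theorem psiStableAlongReachesM (p N : ℕ) : PsiStableAlongReachesM.{u} p N :=
  psiStableAlongReachesM_of_nearStep p N (psiStableNearStepM p N)

/-- **The embedding dimension is constant along canonical near chains from a maximal origin**
(`Moving.EdimStableAlongReachesM`, PROVED — what the `QEdim4` / E5 cells of `…Corridor3WLadderMovingCells` consume):
`edim s = edim (MarkedStage.init X x)` at every reached stage `s`. [cite: CossartJannsenSaito2020, Def. 2.28] -/
theorem edimStableAlongReachesM (p N : ℕ) : EdimStableAlongReachesM.{u} p N :=
  edimStableAlongReachesM_of_psiStable p N (psiStableAlongReachesM p N)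

/-- `φ^N` is constant along canonical near chains from a maximal origin (`φ = N - ψ`). [cite: CossartJannsenSaito2020, Def. 2.28 (2)] -/
theorem hsPhi_eq_of_reaches {p : ℕ} {R : ∀ S : Scheme.{u}, CentreSeq S → Prop} (hRf : OracleFunctional R)
    (hRa : OracleAdmissible R) {N : ℕ} {ν : ℕ → ℕ} {X : Scheme.{u}} [IsLocallyNoetherian X] {x : X}
    (hX : IsMaximalOrigin p N ν X x) {s : MarkedStage.{u}} (hs : Reaches R N ν (MarkedStage.init X x) s) :
    Scheme.hsPhi s.W N s.pt = Scheme.hsPhi X N x := by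
  show N - Scheme.hsPsi s.W s.pt = N - Scheme.hsPsi X x
  rw [psiStableAlongReachesM p N R hRf hRa ν X x hX s hs]

/-- **`dim 𝒪_{X_n,x_n} = dim 𝒪_{X,x}` along canonical near chains from a maximal origin** (by-product).
[cite: CossartJannsenSaito2020, Thm. 3.10 (1)] -/
theorem ringKrullDim_stalk_eq_of_reaches {p : ℕ} {R : ∀ S : Scheme.{u}, CentreSeq S → Prop} (hRf : OracleFunctional R)
    (hRa : OracleAdmissible R) {N : ℕ} {ν : ℕ → ℕ} {X : Scheme.{u}} [IsLocallyNoetherian X] {x : X}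
    (hX : IsMaximalOrigin p N ν X x) {s : MarkedStage.{u}} (hs : Reaches R N ν (MarkedStage.init X x) s) :
    ringKrullDim (s.W.presheaf.stalk s.pt) = ringKrullDim (X.presheaf.stalk x) := by
  induction hs with
  | refl => rfl
  | tail hst hstep ih => rw [ringKrullDim_stalk_eq_of_canonicalNearStep hRf hRa hX hst hstep, ih]

/-- The `QEdim4` door read at ANY reached stage: `edim s ≤ 4 ↔ QEdim4` at the origin. [folklore] -/
theorem edim_le_four_iff_qEdim4_of_reaches {p : ℕ} {R : ∀ S : Scheme.{u}, CentreSeq S → Prop} (hRf : OracleFunctional R)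
    (hRa : OracleAdmissible R) {N : ℕ} {ν : ℕ → ℕ} {X : Scheme.{u}} [IsLocallyNoetherian X] {x : X}
    (hX : IsMaximalOrigin p N ν X x) {s : MarkedStage.{u}} (hs : Reaches R N ν (MarkedStage.init X x) s) :
    edim s ≤ 4 ↔ QEdim4 N ν X x := by
  rw [edimStableAlongReachesM p N R hRf hRa ν X x hX s hs, qEdim4_iff_edim_init N ν X x]


/-! ## §5. (v2, append-only) The Hilbert function of the LOCAL RING is constant along canonical near chains

With `ψ` constant (§3–§4) the near equality `H^N_{X_{n+1}}(x_{n+1}) = H^N_{X_n}(x_n)` reads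
`(H^{(0)}_{𝒪'})^{(N-ψ)} = (H^{(0)}_{𝒪})^{(N-ψ)}` with the SAME shift, and partial summation is injective (CJS Rem. 2.29 (b), tree
`iterPSum_injective`): the unshifted Hilbert functions of the local rings agree, `H^{(0)}(𝒪_{X_{n+1},x_{n+1}}) = H^{(0)}(𝒪_{X_n,x_n})`
— the `d = 0` (closed-point) instance, along canonical near steps, of the alignment «`H^{(d+1)}(𝒪') = H^{(1)}(𝒪)` at near points»
that RULINGS v3.10-3 (a) (AL) asks of permissible blow-ups in general (owner res-L1-type-o1; this section is input, not that lemma). -/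

/-- `H^N` is constant along one canonical near step from a stage reached from a maximal origin (both marked points lie in the
`ν`-stratum). [folklore] -/
theorem hsFun_eq_of_canonicalNearStep {p : ℕ} {R : ∀ S : Scheme.{u}, CentreSeq S → Prop} {N : ℕ} {ν : ℕ → ℕ}
    {X : Scheme.{u}} [IsLocallyNoetherian X] {x : X} (hX : IsMaximalOrigin p N ν X x) {s s' : MarkedStage.{u}}
    (hs : Reaches R N ν (MarkedStage.init X x) s) (h : CanonicalNearStep R N ν s s') :
    @Scheme.hsFun s'.W N s'.pt = @Scheme.hsFun s.W N s.pt := by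
  have h1 := mem_hsStratum_of_reaches (R := R) hX.mem_stratum hs
  have h2 := mem_hsStratum_of_reaches (R := R) hX.mem_stratum (hs.tail h)
  rw [Scheme.mem_hsStratum_iff] at h1 h2
  rw [h1, h2]

/-- **The Hilbert function `H^{(0)}(𝒪_{x_n})(m) = dim_κ 𝔪^m/𝔪^{m+1}` of the local ring is unchanged along one canonical near step**
from a stage reached from a maximal origin (functional admissible oracle): `ψ` is constant (`psiStableNearStepM`), so the near
equality of `H^N = (H^{(0)})^{(N-ψ)}` has the same shift on both sides, and `ν ↦ ν^{(t)}` is injective.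
[cite: CossartJannsenSaito2020, Def. 2.28, Rem. 2.29 (b)] -/
theorem hilbertFun_stalk_eq_of_canonicalNearStep {p : ℕ} {R : ∀ S : Scheme.{u}, CentreSeq S → Prop}
    (hRf : OracleFunctional R) (hRa : OracleAdmissible R) {N : ℕ} {ν : ℕ → ℕ} {X : Scheme.{u}} [IsLocallyNoetherian X]
    {x : X} (hX : IsMaximalOrigin p N ν X x) {s s' : MarkedStage.{u}} (hs : Reaches R N ν (MarkedStage.init X x) s)
    (h : CanonicalNearStep R N ν s s') :
    hilbertFun (s'.W.presheaf.stalk s'.pt) = hilbertFun (s.W.presheaf.stalk s.pt) := by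
  have hH := hsFun_eq_of_canonicalNearStep hX hs h
  have hψ := psiStableNearStepM p N R hRf hRa ν X x hX s s' hs h
  rw [Scheme.hsFun_def, Scheme.hsFun_def, hψ] at hH
  exact iterPSum_injective _ hH

/-- Hence **every Hilbert–Samuel function `H^{(t)}` of the local ring is unchanged along one canonical near step** from a reached
stage. [cite: CossartJannsenSaito2020, Def. 2.28, Rem. 2.29 (b)] -/
theorem hilbertSamuelFun_stalk_eq_of_canonicalNearStep {p : ℕ} {R : ∀ S : Scheme.{u}, CentreSeq S → Prop}
    (hRf : OracleFunctional R) (hRa : OracleAdmissible R) {N : ℕ} {ν : ℕ → ℕ} {X : Scheme.{u}} [IsLocallyNoetherian X]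
    {x : X} (hX : IsMaximalOrigin p N ν X x) {s s' : MarkedStage.{u}} (hs : Reaches R N ν (MarkedStage.init X x) s)
    (h : CanonicalNearStep R N ν s s') (t : ℕ) :
    hilbertSamuelFun (s'.W.presheaf.stalk s'.pt) t = hilbertSamuelFun (s.W.presheaf.stalk s.pt) t := by
  rw [hilbertSamuelFun, hilbertSamuelFun, hilbertFun_stalk_eq_of_canonicalNearStep hRf hRa hX hs h]

/-- **Along canonical near chains from a maximal origin the local rings `𝒪_{X_n,x_n}` all have the Hilbert function of
`𝒪_{X,x}`** (chain form). [cite: CossartJannsenSaito2020, Def. 2.28, Rem. 2.29 (b)] -/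
theorem hilbertFun_stalk_eq_of_reaches {p : ℕ} {R : ∀ S : Scheme.{u}, CentreSeq S → Prop} (hRf : OracleFunctional R)
    (hRa : OracleAdmissible R) {N : ℕ} {ν : ℕ → ℕ} {X : Scheme.{u}} [IsLocallyNoetherian X] {x : X}
    (hX : IsMaximalOrigin p N ν X x) {s : MarkedStage.{u}} (hs : Reaches R N ν (MarkedStage.init X x) s) :
    hilbertFun (s.W.presheaf.stalk s.pt) = hilbertFun (X.presheaf.stalk x) := by
  induction hs with
  | refl => rfl
  | tail hst hstep ih => rw [hilbertFun_stalk_eq_of_canonicalNearStep hRf hRa hX hst hstep, ih]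

/-- Chain form for every `H^{(t)}`. [cite: CossartJannsenSaito2020, Def. 2.28, Rem. 2.29 (b)] -/
theorem hilbertSamuelFun_stalk_eq_of_reaches {p : ℕ} {R : ∀ S : Scheme.{u}, CentreSeq S → Prop} (hRf : OracleFunctional R)
    (hRa : OracleAdmissible R) {N : ℕ} {ν : ℕ → ℕ} {X : Scheme.{u}} [IsLocallyNoetherian X] {x : X}
    (hX : IsMaximalOrigin p N ν X x) {s : MarkedStage.{u}} (hs : Reaches R N ν (MarkedStage.init X x) s) (t : ℕ) :
    hilbertSamuelFun (s.W.presheaf.stalk s.pt) t = hilbertSamuelFun (X.presheaf.stalk x) t := by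
  rw [hilbertSamuelFun, hilbertSamuelFun, hilbertFun_stalk_eq_of_reaches hRf hRa hX hs]

end Summit.ResolutionOfSingularities.ResolutionOfSingularities.Theorems.SigmaMaxModificationsCorridor3.Moving

end
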